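import Literature.NumberTheory.Automorphic.UnitaryThreeDoubleCosetsAnisotropic
import HarnessLib

/-!
# Flicker's second double-coset decomposition `G = ⊔_{m ≥ 0} H″ d_m K` of the quasi-split `p`-adic `U(3)` — the stabiliser `H′_m = H″ ∩ d_m K d_m⁻¹` by congruences
# (Flicker 1998, «Elementary proof of the fundamental lemma for a unitary group», Prop. 4 p. 80 and p. 82)

Topic `NumberTheory/Automorphic`; namespace `Literature.NumberTheory.Automorphic.UnitaryGroup`.  THEOREMS ONLY (no `def`, no instance, no notation, no named fact,
no `sorry`).  Cell `pub/hodgecm-mathlib`, ENGINE T1 (crux H413 = `stmt-HodgeConjecture-24833`); books row #103-ns, road «N7-ns COUNT FROM FLICKER» (MAP v3,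
architect A-p06 (g26)), brick **(F1′)(C′)** (B-p14 (g30)'s split 04:36Z∕05:16Z: (A′)(B′) = ★ `UnitaryThreeDoubleCosetsAnisotropic` (B-p14), (C′) = this file;
author B-p17 (g24), 2026-09-01).  Frame = ★ (F1) + ★ (A′): `LocalConjDatum σ ϖ`, `U = U(σ, Φ₃)(K)`, `K₀ = unitaryInt σ J`, the anisotropic vector
`w₀ = ![1, 0, −2ϖ]` (`B₀ w₀ w₀ = −4ϖ`), `H″ = Stab_U(w₀)` (hypothesis `hw : ↑↑h *ᵥ w₀ = w₀`), `d_m = diag(ϖ^m, 1, ϖ^{−m})` (hypothesis `hdm`).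
* `exists_coe_eq_of_mulVec_anisoVec_eq` — SHAPE: `h w₀ = w₀ ⇒ ↑↑h = !![1+2ϖb, q, b; 2ϖr, s, r; 4ϖ²b, 2ϖq, 1+2ϖb]` (`h` preserves `w₀^⊥ = span(e₀+2ϖe₂, e₁)` by
  ★ `B₀_mulVec_mulVec_of_mem`; four free entries `b q r s`).
* `coe_flickerDiag_inv_mul_mul_flickerDiag` — the explicit conjugate `d_m⁻¹ h d_m = !![1+2ϖb, q∕t, b∕t²; 2ϖrt, s, r∕t; 4ϖ²bt², 2ϖqt, 1+2ϖb]` (`t = ϖ^m`; p. 82 top display).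
* **`flickerDiag_inv_mul_mul_flickerDiag_mem_unitaryInt_iff`** — `d_m⁻¹ h d_m ∈ K₀ ↔ |q| ≤ |t| ∧ |b| ≤ |t|² ∧ |r| ≤ |t| ∧ |s| ≤ 1`: Flicker's `H′_m` conditions
  `|c∕u| ≤ |π|^m` (`q, r`) and `|a∕u − e| ≤ |π|^{1+2m}` (`a∕u − e ↔ 4ϖb`), the set Prop. 16's count (B-p14, LAYER B′) runs over.
HONEST LABEL: HC_CM is proved only modulo the printed citations until rung 0 closes; structure theory for ONE clause of #103-ns, pays nothing by itself.

## References
* [Flicker1998UnitaryFL] Y. Z. Flicker, *Elementary proof of the fundamental lemma for a unitary group*, Canad. J. Math. 50 (1998), Prop. 4 pp. 80–82 (`H″`, `H′_m`),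
  Prop. 16 p. 96.
* [Rogawski1990] J. D. Rogawski, *Automorphic Representations of Unitary Groups in Three Variables* (1990), §1.9 p. 8 (the form `Φ`). -/

open scoped MatrixGroups WithZero
open Matrix

namespace Literature.NumberTheory.Automorphic

namespace UnitaryGroup

open Literature.NumberTheory.Automorphic.HermitianLattice

section AnisoStabilizer

variable {K : Type*} [Field K] [Valued K ℤᵐ⁰] {ϖ : K}
  (σ : K →+* K) {J : Matrix (Fin 3) (Fin 3) K} (hJ : J = (StdForm.antidiagonal 3).over K)

include hJ in
/-- **Shape of the stabiliser `H″ = Stab_U(w₀)`, `w₀ = e₀ − 2ϖe₂`** (fraction-free form): an element `h ∈ U` with `h w₀ = w₀` preserves the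
anisotropic plane `w₀^⊥ = span(e₀ + 2ϖe₂, e₁)` and has the matrix `!![1+2ϖb, q, b; 2ϖr, s, r; 4ϖ²b, 2ϖq, 1+2ϖb]` (`b = h₀₂, q = h₀₁, r = h₁₂, s = h₁₁`;
Flicker's `diag(u⁻¹[a, cπ; c̄, ā], e)` read in the `Φ₃` frame: `a∕u − e ↔ 4ϖb`, `c∕u ↔ q, r`). [cite: Flicker1998UnitaryFL, Prop. 4 pp. 80–82] -/
theorem exists_coe_eq_of_mulVec_anisoVec_eq (hd : LocalConjDatum σ ϖ) {h : ↥(unitaryGroupOfForm σ J)}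
    (hw : ((h : GL (Fin 3) K) : Matrix (Fin 3) (Fin 3) K) *ᵥ ![1, 0, -(2 * ϖ)] = ![1, 0, -(2 * ϖ)]) :
    ∃ b q r s : K, ((h : GL (Fin 3) K) : Matrix (Fin 3) (Fin 3) K) =
      !![1 + 2 * ϖ * b, q, b; 2 * ϖ * r, s, r; 4 * ϖ ^ 2 * b, 2 * ϖ * q, 1 + 2 * ϖ * b] := by
  have h2 : (2 : K) ≠ 0 := fun h0 => by have := hd.v2; rw [h0, map_zero] at this; exact zero_ne_one this
  have hϖ := hd.ϖ_ne_zero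
  have h22 : (2 : K)⁻¹ * 2 = 1 := inv_mul_cancel₀ h2
  have h4ϖ : (4 * ϖ : K)⁻¹ * (4 * ϖ) = 1 :=
    inv_mul_cancel₀ (mul_ne_zero (by rw [show (4 : K) = 2 * 2 by norm_num]; exact mul_ne_zero h2 h2) hϖ)
  set M := ((h : GL (Fin 3) K) : Matrix (Fin 3) (Fin 3) K) with hM
  -- `h w₀ = w₀`, componentwise
  have e0 := congrFun hw 0
  have e1 := congrFun hw 1
  have e2 := congrFun hw 2
  simp [Matrix.mulVec, dotProduct, Fin.sum_univ_three] at e0 e1 e2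
  -- `h` preserves `w₀^⊥`: `B₀ w₀ (h v) = B₀ (h w₀) (h v) = B₀ w₀ v`
  have horth : ∀ v : Fin 3 → K, B₀ σ 3 ![1, 0, -(2 * ϖ)] (M *ᵥ v) = B₀ σ 3 ![1, 0, -(2 * ϖ)] v := by
    intro v
    have := B₀_mulVec_mulVec_of_mem σ hJ h ![1, 0, -(2 * ϖ)] v
    rwa [hw] at this
  have o1 := horth ![1, 0, 2 * ϖ]
  have o2 := horth ![0, 1, 0]
  simp [B₀_apply, Matrix.mulVec, dotProduct, Fin.sum_univ_three, Fin.rev, map_neg, map_mul, map_ofNat, hd.σϖ] at o1 o2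
  refine ⟨M 0 2, M 0 1, M 1 2, M 1 1, ?_⟩
  ext i j
  fin_cases i <;> fin_cases j <;> simp
  · linear_combination e0
  · linear_combination e1
  · linear_combination (2 : K)⁻¹ * o1 + (2 : K)⁻¹ * e2 + (2 : K)⁻¹ * (2 * ϖ) * e0 - (M 2 0 - 4 * ϖ ^ 2 * M 0 2) * h22
  · linear_combination o2
  · linear_combination (4 * ϖ : K)⁻¹ * o1 - (4 * ϖ : K)⁻¹ * e2 + (4 * ϖ : K)⁻¹ * (2 * ϖ) * e0 -
      (M 2 2 - (1 + 2 * ϖ * M 0 2)) * h4ϖ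

/-- **The conjugate `d_m⁻¹ h d_m` of a stabiliser element, explicitly** (`t = ϖ^m`, `d_m = diag(t, 1, t⁻¹)`):
`d_m⁻¹ · !![1+2ϖb, q, b; 2ϖr, s, r; 4ϖ²b, 2ϖq, 1+2ϖb] · d_m = !![1+2ϖb, q∕t, b∕t²; 2ϖrt, s, r∕t; 4ϖ²bt², 2ϖqt, 1+2ϖb]` (Flicker p. 82, top display).
[cite: Flicker1998UnitaryFL, Prop. 4 p. 82] -/
theorem coe_flickerDiag_inv_mul_mul_flickerDiag (hd : LocalConjDatum σ ϖ) (m : ℕ) {d h : ↥(unitaryGroupOfForm σ J)}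
    (hdm : ((d : GL (Fin 3) K) : Matrix (Fin 3) (Fin 3) K) = !![ϖ ^ m, 0, 0; 0, 1, 0; 0, 0, (ϖ ^ m)⁻¹]) {b q r s : K}
    (hh : ((h : GL (Fin 3) K) : Matrix (Fin 3) (Fin 3) K) = !![1 + 2 * ϖ * b, q, b; 2 * ϖ * r, s, r; 4 * ϖ ^ 2 * b, 2 * ϖ * q, 1 + 2 * ϖ * b]) :
    (((d⁻¹ * h * d : ↥(unitaryGroupOfForm σ J)) : GL (Fin 3) K) : Matrix (Fin 3) (Fin 3) K) =
      !![1 + 2 * ϖ * b, q * (ϖ ^ m)⁻¹, b * (ϖ ^ m)⁻¹ * (ϖ ^ m)⁻¹; 2 * ϖ * r * ϖ ^ m, s, r * (ϖ ^ m)⁻¹;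
         4 * ϖ ^ 2 * b * ϖ ^ m * ϖ ^ m, 2 * ϖ * q * ϖ ^ m, 1 + 2 * ϖ * b] := by
  have ht0 : ϖ ^ m ≠ 0 := pow_ne_zero _ hd.ϖ_ne_zero
  have key : ((h : GL (Fin 3) K) : Matrix (Fin 3) (Fin 3) K) * ((d : GL (Fin 3) K) : Matrix (Fin 3) (Fin 3) K) =
      ((d : GL (Fin 3) K) : Matrix (Fin 3) (Fin 3) K) *
        !![1 + 2 * ϖ * b, q * (ϖ ^ m)⁻¹, b * (ϖ ^ m)⁻¹ * (ϖ ^ m)⁻¹; 2 * ϖ * r * ϖ ^ m, s, r * (ϖ ^ m)⁻¹;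
           4 * ϖ ^ 2 * b * ϖ ^ m * ϖ ^ m, 2 * ϖ * q * ϖ ^ m, 1 + 2 * ϖ * b] := by
    rw [hh, hdm]
    simp only [Matrix.mul_fin_three]
    ext i j
    fin_cases i <;> fin_cases j <;> simp only [Matrix.of_apply, Matrix.cons_val', Matrix.cons_val_zero, Matrix.cons_val_one,
      Matrix.cons_val_fin_one, Matrix.cons_val, Matrix.empty_val', Fin.mk_one, Fin.zero_eta, Fin.reduceFinMk, mul_zero, zero_mul,
      add_zero, zero_add, mul_one, one_mul]
    all_goals field_simp
  rw [Subgroup.coe_mul, Subgroup.coe_mul, Units.val_mul, Units.val_mul, Matrix.mul_assoc, key, ← Matrix.mul_assoc, Subgroup.coe_inv,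
    Units.inv_mul, Matrix.one_mul]

include hJ in
/-- **`H′_m = Stab(w₀) ∩ d_m K₀ d_m⁻¹` BY CONGRUENCES** [Flicker1998UnitaryFL Prop. 4, p. 80 ∕ p. 82]: for `h = !![1+2ϖb, q, b; 2ϖr, s, r; 4ϖ²b, 2ϖq, 1+2ϖb] ∈ U`
and `t = ϖ^m`, `d_m⁻¹ h d_m ∈ K₀ ↔ |q| ≤ |t| ∧ |b| ≤ |t|² ∧ |r| ≤ |t| ∧ |s| ≤ 1` — Flicker's `|c∕u| ≤ |π|^m` (`q, r`) and `|a∕u − e| ≤ |π|^{1+2m}`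
(`a∕u − e ↔ 4ϖb`, `|4ϖb| ≤ |ϖ|^{2m+1} ↔ |b| ≤ |ϖ|^{2m}`); the set Prop. 16's count runs over. [cite: Flicker1998UnitaryFL, Prop. 4 p. 82; Prop. 16 p. 96] -/
theorem flickerDiag_inv_mul_mul_flickerDiag_mem_unitaryInt_iff (hd : LocalConjDatum σ ϖ) (m : ℕ) {d h : ↥(unitaryGroupOfForm σ J)}
    (hdm : ((d : GL (Fin 3) K) : Matrix (Fin 3) (Fin 3) K) = !![ϖ ^ m, 0, 0; 0, 1, 0; 0, 0, (ϖ ^ m)⁻¹]) {b q r s : K}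
    (hh : ((h : GL (Fin 3) K) : Matrix (Fin 3) (Fin 3) K) = !![1 + 2 * ϖ * b, q, b; 2 * ϖ * r, s, r; 4 * ϖ ^ 2 * b, 2 * ϖ * q, 1 + 2 * ϖ * b]) :
    d⁻¹ * h * d ∈ unitaryInt σ J ↔
      Valued.v q ≤ Valued.v (ϖ ^ m) ∧ Valued.v b ≤ Valued.v (ϖ ^ m) * Valued.v (ϖ ^ m) ∧ Valued.v r ≤ Valued.v (ϖ ^ m) ∧
        Valued.v s ≤ 1 := by
  have h2 : Valued.v (2 : K) = 1 := hd.v2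
  have h4 : Valued.v (4 : K) = 1 := by rw [show (4 : K) = 2 * 2 by norm_num, map_mul, h2, one_mul]
  have hϖ1 : Valued.v ϖ ≤ 1 := by rw [hd.vϖ, ← WithZero.exp_zero]; exact WithZero.exp_le_exp.2 (by norm_num)
  have ht0 : Valued.v (ϖ ^ m) ≠ 0 := (Valuation.ne_zero_iff _).2 (pow_ne_zero _ hd.ϖ_ne_zero)
  have htpos : 0 < Valued.v (ϖ ^ m) := zero_lt_iff.2 ht0
  have ht1 : Valued.v (ϖ ^ m) ≤ 1 := by rw [map_pow]; exact pow_le_one' hϖ1 m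
  rw [mem_unitaryInt_iff_forall_v_apply_le_one σ hJ hd.vσ, coe_flickerDiag_inv_mul_mul_flickerDiag σ hd m hdm hh]
  constructor
  · intro H
    have e01 := H 0 1; have e02 := H 0 2; have e11 := H 1 1; have e12 := H 1 2
    simp only [Matrix.of_apply, Matrix.cons_val', Matrix.cons_val_zero, Matrix.cons_val_one, Matrix.cons_val_fin_one, Matrix.cons_val,
      Matrix.empty_val', map_mul, map_inv₀] at e01 e02 e11 e12
    refine ⟨?_, ?_, ?_, e11⟩
    · rwa [mul_inv_le_iff₀ htpos, one_mul] at e01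
    · rwa [mul_inv_le_iff₀ htpos, one_mul, mul_inv_le_iff₀ htpos] at e02
    · rwa [mul_inv_le_iff₀ htpos, one_mul] at e12
  · rintro ⟨hq, hb, hr, hs⟩
    have hb1 : Valued.v b ≤ 1 := hb.trans (mul_le_one' ht1 ht1)
    have hdiag : Valued.v (1 + 2 * ϖ * b) ≤ 1 :=
      Valuation.map_add_le _ (by rw [map_one]) (by rw [map_mul, map_mul, h2, one_mul]; exact mul_le_one' hϖ1 hb1)
    intro i j
    fin_cases i <;> fin_cases j <;>
      simp only [Matrix.of_apply, Matrix.cons_val', Matrix.cons_val_zero, Matrix.cons_val_one, Matrix.cons_val_fin_one, Matrix.cons_val,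
        Matrix.empty_val', Fin.mk_one, Fin.zero_eta, Fin.reduceFinMk, map_mul, map_inv₀, h2, h4, one_mul]
    · exact hdiag
    · rw [mul_inv_le_iff₀ htpos, one_mul]; exact hq
    · rw [mul_inv_le_iff₀ htpos, one_mul, mul_inv_le_iff₀ htpos]; exact hb
    · exact mul_le_one' (mul_le_one' hϖ1 (hr.trans ht1)) ht1
    · exact hs
    · rw [mul_inv_le_iff₀ htpos, one_mul]; exact hr
    · have hϖ2 : Valued.v (ϖ ^ 2) ≤ 1 := by rw [map_pow]; exact pow_le_one' hϖ1 2
      calc Valued.v (ϖ ^ 2) * Valued.v b * Valued.v (ϖ ^ m) * Valued.v (ϖ ^ m)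
          ≤ 1 * (Valued.v (ϖ ^ m) * Valued.v (ϖ ^ m)) * 1 * 1 :=
            mul_le_mul' (mul_le_mul' (mul_le_mul' hϖ2 hb) ht1) ht1
        _ ≤ 1 := by rw [one_mul, mul_one, mul_one]; exact mul_le_one' ht1 ht1
    · exact mul_le_one' (mul_le_one' hϖ1 (hq.trans ht1)) ht1
    · exact hdiag

end AnisoStabilizer

end UnitaryGroup

end Literature.NumberTheory.Automorphic
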